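import Mathlib
import HarnessLib
import Summits.Ventures.LatticeQCDFlow.Exactness.FlowPushforward
import Summits.Ventures.LatticeQCDFlow.Exactness.TorusCircleChart
import Summits.Ventures.LatticeQCDFlow.Exactness.SU2TorusAlcoveJacobian

/-!
# The gap chart of the `SU(N)` alcove, every `N`: the open simplex `{ρ_k > 0, Σρ < 1}` is carried LINEARLY onto the alcove `{x strictly increasing, x_last < x_0 + 2π}` (gaps `x_{k+1} − x_k = 2πρ_k`), so simplex flows become alcove flows with the SAME Jacobian

HONEST FRAMING: exact (Metropolis-corrected) sampling algorithms for lattice gauge theory;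
figures of merit are autocorrelation/cost numbers at stated couplings and volumes; no
continuum-physics claim.

Venture `LatticeQCDFlow` (cell pub-lqcd), topic `Exactness`; FANOUT row 10 (`eng-equiv`, engine
`latflow.equiv` `spectral.zeta` / `simplex_vertices(N)`: the cell is an affine image of the right
simplex, "zeta is affine: its factors cancel"; Boyda et al., PRD 103 (2021) 074504 eq. (21)).  NEW WORK
of the cell: the every-`N` companion of `AlcoveAffineChartSU3.lean`, in the GAP normal form (the
barycentric coordinates of the alcove are the consecutive gaps `/2π`; Boyda's `ζ` is this chart up to
a relabelling of the simplex vertices).  Over Mathlib (`map_linearMap_addHaar_eq_smul_addHaar`) and this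
row's `hasJacobian_of_presentation_ae`.  Nothing is cited as a fact; no number; no definition (the chart
enters through the characterising hypothesis `hZ`); the Jacobian constant `|det Z|` is carried
symbolically — it cancels.

## What is typed (`N = n + 1`; `x(θ) = Fin.snoc θ (−Σθ)`; `Z ρ = (x₀(ρ) + 2π Σ_{k<i} ρ_k)_i`,
`x₀(ρ) = −(2π/(n+1)) Σ_k (n−k) ρ_k`; `Δ° = {ρ_k > 0, Σρ < 1}`; `A = {x strictly increasing, x_n < x_0 + 2π}`)

* `phases_gapChart` — `x(Zρ)_i = x₀(ρ) + 2π Σ_{k<i} ρ_k` for ALL `i ≤ n` (the last phase too, by `Σx = 0`);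
  `gap_gapChart` — `x(Zρ)_{k+1} − x(Zρ)_k = 2πρ_k`; `gapChart_injective`;
* **`image_gapChart`** — `Z(Δ°) = A`;
* **`map_gapChart`** — `Z_* (|det Z| · Leb|_{Δ°}) = Leb|_A`;
* **`hasJacobian_alcove_of_simplexFlow_sun`** — a simplex flow `G'` with `HasJacobian (Leb|_{Δ°}) G' J'`
  intertwined through `Z` with an alcove map `G` (`J ∘ Z = J'`) gives `HasJacobian (Leb|_A) G J`.

NOT here: the general stick-breaking chart `(0,1)ⁿ → Δ°` (the every-`N` version of
`StickBreakingFinTwo.lean`); any number.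
-/

noncomputable section

namespace Summit.Ventures.LatticeQCDFlow.Exactness

open MeasureTheory Set Real Finset
open scoped ENNReal

variable {n : ℕ} {Z : (Fin n → ℝ) → (Fin n → ℝ)}
  (hZ : ∀ ρ i, Z ρ i = -(2 * π / (n + 1)) * (∑ k : Fin n, ((n : ℝ) - k) * ρ k) + 2 * π * ∑ k ∈ Finset.Iio i, ρ k)

include hZ

omit hZ in
/-- The double sum `Σ_i Σ_{k<i} ρ_k = Σ_k (n − 1 − k) ρ_k`. -/
theorem sum_sum_Iio_eq (ρ : Fin n → ℝ) :
    ∑ i : Fin n, ∑ k ∈ Finset.Iio i, ρ k = ∑ k : Fin n, ((n : ℝ) - 1 - k) * ρ k := by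
  have h : ∑ i : Fin n, ∑ k ∈ Finset.Iio i, ρ k = ∑ k : Fin n, ∑ i ∈ Finset.Ioi k, ρ k := by
    refine Finset.sum_comm' fun k i => ?_
    simp only [Finset.mem_Iio, Finset.mem_Ioi, Finset.mem_univ, and_true, true_and]
  rw [h]
  refine Finset.sum_congr rfl fun k _ => ?_
  rw [Finset.sum_const, nsmul_eq_mul, Fin.card_Ioi]
  congr 1
  have hk : (k : ℕ) + 1 ≤ n := k.2
  rw [Nat.sub_sub, Nat.cast_sub (by omega), Nat.cast_add, Nat.cast_one]
  ring

/-- **The phases of the gap chart**: for every `i ≤ n`, `x(Zρ)_i = x₀(ρ) + 2π Σ_{k<i} ρ_k`. -/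
theorem phases_gapChart (ρ : Fin n → ℝ) (i : Fin (n + 1)) :
    (Fin.snoc (Z ρ) (-∑ k, Z ρ k) : Fin (n + 1) → ℝ) i =
      -(2 * π / (n + 1)) * (∑ k : Fin n, ((n : ℝ) - k) * ρ k) +
        2 * π * ∑ k ∈ Finset.univ.filter (fun k : Fin n => k.castSucc < i), ρ k := by
  induction i using Fin.lastCases with
  | last =>
    rw [Fin.snoc_last]
    have hfilter : Finset.univ.filter (fun k : Fin n => k.castSucc < Fin.last n) = Finset.univ := by
      ext k
      simp [Fin.castSucc_lt_last]
    rw [hfilter]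
    simp_rw [hZ]
    rw [Finset.sum_add_distrib, Finset.sum_const, Finset.card_univ, Fintype.card_fin, nsmul_eq_mul,
      ← Finset.mul_sum, sum_sum_Iio_eq]
    have hn : ((n : ℝ) + 1) ≠ 0 := by positivity
    have hsplit : ∑ k : Fin n, ((n : ℝ) - k) * ρ k = ∑ k : Fin n, ((n : ℝ) - 1 - k) * ρ k + ∑ k : Fin n, ρ k := by
      rw [← Finset.sum_add_distrib]
      exact Finset.sum_congr rfl fun k _ => by ring
    field_simp
    rw [hsplit]
    ring
  | cast j =>
    rw [Fin.snoc_castSucc, hZ]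
    congr 2
    refine Finset.sum_congr ?_ fun _ _ => rfl
    ext k
    simp [Fin.castSucc_lt_castSucc_iff]

/-- **The gaps of the gap chart are `2πρ_k`.** -/
theorem gap_gapChart (ρ : Fin n → ℝ) (k : Fin n) :
    (Fin.snoc (Z ρ) (-∑ k, Z ρ k) : Fin (n + 1) → ℝ) k.succ -
      (Fin.snoc (Z ρ) (-∑ k, Z ρ k) : Fin (n + 1) → ℝ) k.castSucc = 2 * π * ρ k := by
  rw [phases_gapChart hZ, phases_gapChart hZ]
  have hfilter : Finset.univ.filter (fun k' : Fin n => k'.castSucc < k.succ) =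
      insert k (Finset.univ.filter (fun k' : Fin n => k'.castSucc < k.castSucc)) := by
    ext k'
    simp only [Finset.mem_filter, Finset.mem_univ, true_and, Finset.mem_insert, Fin.castSucc_lt_castSucc_iff,
      Fin.castSucc_lt_succ_iff]
    exact le_iff_eq_or_lt
  have hnot : k ∉ Finset.univ.filter (fun k' : Fin n => k'.castSucc < k.castSucc) := by simp
  rw [hfilter, Finset.sum_insert hnot]
  ring

/-- **The gap chart is injective** (the gaps determine `ρ`). -/
theorem gapChart_injective : Function.Injective Z := by
  intro ρ ρ' h
  funext k
  have h1 := gap_gapChart hZ ρ k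
  have h2 := gap_gapChart hZ ρ' k
  rw [h] at h1
  have hπ : (0 : ℝ) < 2 * π := by positivity
  nlinarith [h1, h2, hπ]

/-- The gap chart is linear: additive. -/
theorem gapChart_add (ρ ρ' : Fin n → ℝ) : Z (ρ + ρ') = Z ρ + Z ρ' := by
  funext i
  simp only [hZ, Pi.add_apply, Finset.sum_add_distrib, mul_add]
  ring

/-- The gap chart is linear: homogeneous. -/
theorem gapChart_smul (c : ℝ) (ρ : Fin n → ℝ) : Z (c • ρ) = c • Z ρ := by
  funext i
  rw [Pi.smul_apply, hZ, hZ, smul_eq_mul]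
  simp only [Pi.smul_apply, smul_eq_mul]
  have h1 : ∑ k : Fin n, ((n : ℝ) - k) * (c * ρ k) = c * ∑ k : Fin n, ((n : ℝ) - k) * ρ k := by
    rw [Finset.mul_sum]
    exact Finset.sum_congr rfl fun k _ => by ring
  have h2 : ∑ k ∈ Finset.Iio i, c * ρ k = c * ∑ k ∈ Finset.Iio i, ρ k := by rw [Finset.mul_sum]
  rw [h1, h2]
  ring

omit hZ in
/-- The alcove `A = {x strictly increasing, x_n < x_0 + 2π}` is measurable. -/
theorem measurableSet_alcove_sun :
    MeasurableSet {θ : Fin n → ℝ | StrictMono (Fin.snoc θ (-∑ k, θ k) : Fin (n + 1) → ℝ) ∧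
      (Fin.snoc θ (-∑ k, θ k) : Fin (n + 1) → ℝ) (Fin.last n) < (Fin.snoc θ (-∑ k, θ k) : Fin (n + 1) → ℝ) 0 + 2 * π} := by
  have hX : ∀ i : Fin (n + 1), Measurable fun θ : Fin n → ℝ => (Fin.snoc θ (-∑ k, θ k) : Fin (n + 1) → ℝ) i := by
    intro i
    induction i using Fin.lastCases with
    | last =>
      simp only [Fin.snoc_last]
      exact (Finset.measurable_sum _ fun k _ => measurable_pi_apply k).neg
    | cast k =>
      simp only [Fin.snoc_castSucc]
      exact measurable_pi_apply k
  have hset : {θ : Fin n → ℝ | StrictMono (Fin.snoc θ (-∑ k, θ k) : Fin (n + 1) → ℝ) ∧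
      (Fin.snoc θ (-∑ k, θ k) : Fin (n + 1) → ℝ) (Fin.last n) < (Fin.snoc θ (-∑ k, θ k) : Fin (n + 1) → ℝ) 0 + 2 * π} =
      (⋂ a : Fin n, {θ : Fin n → ℝ | (Fin.snoc θ (-∑ k, θ k) : Fin (n + 1) → ℝ) a.castSucc <
        (Fin.snoc θ (-∑ k, θ k) : Fin (n + 1) → ℝ) a.succ}) ∩
      {θ | (Fin.snoc θ (-∑ k, θ k) : Fin (n + 1) → ℝ) (Fin.last n) <
        (Fin.snoc θ (-∑ k, θ k) : Fin (n + 1) → ℝ) 0 + 2 * π} := by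
    ext θ
    rw [Set.mem_setOf_eq, Set.mem_inter_iff, Set.mem_iInter, Fin.strictMono_iff_lt_succ]
    simp only [Set.mem_setOf_eq]
  rw [hset]
  exact (MeasurableSet.iInter fun a => measurableSet_lt (hX _) (hX _)).inter (measurableSet_lt (hX _) ((hX _).add_const _))

/-- **The image of the open simplex is the alcove**: `Z(Δ°) = A`. -/
theorem image_gapChart :
    Z '' {ρ : Fin n → ℝ | (∀ k, 0 < ρ k) ∧ ∑ k, ρ k < 1} =
      {θ : Fin n → ℝ | StrictMono (Fin.snoc θ (-∑ k, θ k) : Fin (n + 1) → ℝ) ∧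
        (Fin.snoc θ (-∑ k, θ k) : Fin (n + 1) → ℝ) (Fin.last n) < (Fin.snoc θ (-∑ k, θ k) : Fin (n + 1) → ℝ) 0 + 2 * π} := by
  have hπ : (0 : ℝ) < 2 * π := by positivity
  -- the linear map packaging of `Z`
  let L : (Fin n → ℝ) →ₗ[ℝ] (Fin n → ℝ) :=
    { toFun := Z, map_add' := gapChart_add hZ, map_smul' := gapChart_smul hZ }
  have hLsurj : Function.Surjective Z := by
    have h : Function.Surjective L := LinearMap.surjective_of_injective (gapChart_injective hZ)
    exact h
  ext θ
  constructor
  · rintro ⟨ρ, ⟨hpos, hsum⟩, rfl⟩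
    refine ⟨?_, ?_⟩
    · rw [Fin.strictMono_iff_lt_succ]
      intro k
      have h := gap_gapChart hZ ρ k
      have hk := hpos k
      nlinarith
    · rw [phases_gapChart hZ, phases_gapChart hZ]
      have h0 : Finset.univ.filter (fun k : Fin n => k.castSucc < (0 : Fin (n + 1))) = ∅ := by
        ext k
        simp
      have hl : Finset.univ.filter (fun k : Fin n => k.castSucc < Fin.last n) = Finset.univ := by
        ext k
        simp [Fin.castSucc_lt_last]
      rw [h0, hl, Finset.sum_empty]
      nlinarith
  · rintro ⟨hmono, hlast⟩
    obtain ⟨ρ, rfl⟩ := hLsurj θ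
    refine ⟨ρ, ⟨fun k => ?_, ?_⟩, rfl⟩
    · have h := gap_gapChart hZ ρ k
      have hlt := hmono (Fin.castSucc_lt_succ_iff.mpr (le_refl k))
      nlinarith
    · rw [phases_gapChart hZ, phases_gapChart hZ] at hlast
      have h0 : Finset.univ.filter (fun k : Fin n => k.castSucc < (0 : Fin (n + 1))) = ∅ := by
        ext k
        simp
      have hl : Finset.univ.filter (fun k : Fin n => k.castSucc < Fin.last n) = Finset.univ := by
        ext k
        simp [Fin.castSucc_lt_last]
      rw [h0, hl, Finset.sum_empty] at hlast
      nlinarith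

omit hZ in
/-- The open simplex is measurable. -/
theorem measurableSet_openSimplex_sun :
    MeasurableSet {ρ : Fin n → ℝ | (∀ k, 0 < ρ k) ∧ ∑ k, ρ k < 1} := by
  have h1 : MeasurableSet {ρ : Fin n → ℝ | ∀ k, 0 < ρ k} := by
    have : {ρ : Fin n → ℝ | ∀ k, 0 < ρ k} = ⋂ k, {ρ | 0 < ρ k} := by ext ρ; simp
    rw [this]
    exact MeasurableSet.iInter fun k => measurableSet_lt measurable_const (measurable_pi_apply k)
  exact h1.inter (measurableSet_lt (Finset.measurable_sum _ fun k _ => measurable_pi_apply k) measurable_const)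

/-- **The gap chart presents Lebesgue measure on the alcove**: `Z_* (|det Z| · Leb|_{Δ°}) = Leb|_A`
(the constant is carried symbolically — only `det Z ≠ 0` matters). -/
theorem map_gapChart :
    Measure.map Z (ENNReal.ofReal |LinearMap.det
        ({ toFun := Z, map_add' := gapChart_add hZ, map_smul' := gapChart_smul hZ } : (Fin n → ℝ) →ₗ[ℝ] (Fin n → ℝ))| •
      (volume : Measure (Fin n → ℝ)).restrict {ρ : Fin n → ℝ | (∀ k, 0 < ρ k) ∧ ∑ k, ρ k < 1}) =
      (volume : Measure (Fin n → ℝ)).restrict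
        {θ : Fin n → ℝ | StrictMono (Fin.snoc θ (-∑ k, θ k) : Fin (n + 1) → ℝ) ∧
          (Fin.snoc θ (-∑ k, θ k) : Fin (n + 1) → ℝ) (Fin.last n) <
            (Fin.snoc θ (-∑ k, θ k) : Fin (n + 1) → ℝ) 0 + 2 * π} := by
  set L : (Fin n → ℝ) →ₗ[ℝ] (Fin n → ℝ) :=
    { toFun := Z, map_add' := gapChart_add hZ, map_smul' := gapChart_smul hZ } with hL
  have hinj : Function.Injective L := gapChart_injective hZ
  have hdet : LinearMap.det L ≠ 0 := by
    have hker : LinearMap.ker L = ⊥ := LinearMap.ker_eq_bot.mpr hinj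
    exact (((LinearMap.isUnit_iff_ker_eq_bot L).mpr hker).map LinearMap.det).ne_zero
  have hZm : Measurable Z := L.continuous_of_finiteDimensional.measurable
  have hmapZ : Measure.map Z (volume : Measure (Fin n → ℝ)) = ENNReal.ofReal |(LinearMap.det L)⁻¹| • volume :=
    Measure.map_linearMap_addHaar_eq_smul_addHaar _ hdet
  have hpre : Z ⁻¹' (Z '' {ρ : Fin n → ℝ | (∀ k, 0 < ρ k) ∧ ∑ k, ρ k < 1}) =
      {ρ : Fin n → ℝ | (∀ k, 0 < ρ k) ∧ ∑ k, ρ k < 1} := (gapChart_injective hZ).preimage_image _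
  have himm : MeasurableSet (Z '' {ρ : Fin n → ℝ | (∀ k, 0 < ρ k) ∧ ∑ k, ρ k < 1}) := by
    rw [image_gapChart hZ]
    exact measurableSet_alcove_sun
  have h1 : Measure.map Z ((volume : Measure (Fin n → ℝ)).restrict {ρ : Fin n → ℝ | (∀ k, 0 < ρ k) ∧ ∑ k, ρ k < 1}) =
      (Measure.map Z (volume : Measure (Fin n → ℝ))).restrict (Z '' {ρ : Fin n → ℝ | (∀ k, 0 < ρ k) ∧ ∑ k, ρ k < 1}) := by
    rw [Measure.restrict_map hZm himm, hpre]
  rw [Measure.map_smul, h1, hmapZ, Measure.restrict_smul, image_gapChart hZ, smul_smul,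
    ← ENNReal.ofReal_mul (abs_nonneg _), ← abs_mul, mul_inv_cancel₀ hdet, abs_one, ENNReal.ofReal_one, one_smul]

/-- **Simplex flows become alcove flows with the same Jacobian, every `N`.**  If `G'` has
`HasJacobian (Leb|_{Δ°}) G' J'`, and `G`, `J` on the alcove are measurable with `G (Z ρ) = Z (G' ρ)` and
`J (Z ρ) = J' ρ` for a.e. `ρ ∈ Δ°`, then `HasJacobian (Leb|_A) G J`. -/
theorem hasJacobian_alcove_of_simplexFlow_sun {G' : (Fin n → ℝ) → (Fin n → ℝ)} {J' : (Fin n → ℝ) → ℝ≥0∞}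
    (hG' : HasJacobian ((volume : Measure (Fin n → ℝ)).restrict {ρ : Fin n → ℝ | (∀ k, 0 < ρ k) ∧ ∑ k, ρ k < 1}) G' J')
    {G : (Fin n → ℝ) → (Fin n → ℝ)} (hG : Measurable G) {J : (Fin n → ℝ) → ℝ≥0∞} (hJ : Measurable J)
    (hcomm : ∀ᵐ ρ ∂((volume : Measure (Fin n → ℝ)).restrict {ρ : Fin n → ℝ | (∀ k, 0 < ρ k) ∧ ∑ k, ρ k < 1}),
      G (Z ρ) = Z (G' ρ))
    (hJ' : ∀ᵐ ρ ∂((volume : Measure (Fin n → ℝ)).restrict {ρ : Fin n → ℝ | (∀ k, 0 < ρ k) ∧ ∑ k, ρ k < 1}),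
      J (Z ρ) = J' ρ) :
    HasJacobian ((volume : Measure (Fin n → ℝ)).restrict
      {θ : Fin n → ℝ | StrictMono (Fin.snoc θ (-∑ k, θ k) : Fin (n + 1) → ℝ) ∧
        (Fin.snoc θ (-∑ k, θ k) : Fin (n + 1) → ℝ) (Fin.last n) <
          (Fin.snoc θ (-∑ k, θ k) : Fin (n + 1) → ℝ) 0 + 2 * π}) G J := by
  have hZm : Measurable Z :=
    (({ toFun := Z, map_add' := gapChart_add hZ, map_smul' := gapChart_smul hZ } :
      (Fin n → ℝ) →ₗ[ℝ] (Fin n → ℝ)).continuous_of_finiteDimensional).measurable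
  refine hasJacobian_of_presentation_ae hZm (map_gapChart hZ) (hG'.smul_measure _) hG hJ ?_ ?_
  · exact Measure.ae_smul_measure hcomm _
  · exact Measure.ae_smul_measure hJ' _

end Summit.Ventures.LatticeQCDFlow.Exactness
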